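import Literature.Analysis.FluidPDE.TorusHeatForcedIcc
import HarnessLib

/-!
# The heat flow acts diagonally on Fourier coefficients: `𝓕(θ(t))(k) = e^{-4π²ν|k|²(t-a)} 𝓕(θ(a))(k)`

Analysis/FluidPDE proof file (theorems only; no definitions, no named facts). For a classical solution
`θ` of the heat equation `∂ₜθ = νΔθ` on `[a, b] × 𝕋^d` (jointly smooth, one-sided time derivative within
`[a, b]`; any real `ν`), every Fourier coefficient of (the complexification of) `θ(t)` is the datum's
coefficient times the Gauss–Weierstrass multiplier: `𝓕(θ(t))(k) = exp(−4π²ν|k|²(t − a)) 𝓕(θ(a))(k)`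
(Stein 1970 Ch. III §2 / Grafakos 2014 Prop. 3.2.6 (8): `𝓕(Δθ) = −4π²|k|²𝓕θ`, and the scalar linear
ODE `c' = −4π²ν|k|² c`). Consequences recorded: the Fourier SUPPORT of the datum is preserved
(`Torus.mFourierCoeff_heat_eq_zero`), the modulus identity, and the BACKWARD (realignment) form
`𝓕(θ(a))(k) = exp(+4π²ν|k|²(t − a)) 𝓕(θ(t))(k)`.

For the cell `ad-ideate` (route `SawtoothPulseCascade`, crux `ApproxSol58` = item 19688, the lead's
census step (i) "Fourier bookkeeping of the realigned comb … backward to tInject": on a half-slot the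
parallel amplitude of the linearised response is a heat flow, `Torus.linearisedNS_parallel_unique` /
support g3's `K2Classical.parallel_H_unique`, so its comb class `ShearCombDatum` — a Fourier-support
condition — is preserved, and the realigned datum is read off coefficient by coefficient).

## Mathlib / tree search

Tree (reused): `ScalarFourier.hasDerivWithinAt_mFourierCoeff`, `ScalarFourier.mFourierCoeff_laplacian`
(`FluidPDE/ScalarFourierData`), `Torus.timeDerivWithin_ofReal`, `Torus.laplacian_ofReal`,
`Torus.hasDerivWithinAt_mFourierCoeff_heatForced` (the `κ = 1` forced coefficient ODE;
`FluidPDE/TorusHeatForcedIcc`), Mathlib `constant_of_derivWithin_zero`. No closed-form multiplier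
statement found (`lean search 'exp.*mFourierCoeff.*heat|heatCoeff.*mFourierCoeff'`: only the heat KERNEL's
own coefficients `Torus.mFourierCoeff_heatKernelC`).

## References

* E. M. Stein, *Singular Integrals and Differentiability Properties of Functions* (1970), Ch. III §2
  (the Gauss–Weierstrass semigroup as the multiplier `e^{-4π²t|ξ|²}`). [`Stein1970`]
* L. Grafakos, *Classical Fourier Analysis* (2014), Prop. 3.2.6 (8). [`Grafakos2014`]
-/

noncomputable section

open MeasureTheory Set Filter Function Complex UnitAddTorus
open scoped ContDiff Topology

namespace Literature.Analysis.FluidPDE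

open Literature.Analysis.FunctionSpaces

variable {d : Type*} [Fintype d] [DecidableEq d]

/-- **The coefficient ODE of a classical heat solution** (any real `ν`): if `∂ₜθ = νΔθ` on
`[a, b] × 𝕋^d` (`a < b`, `θ` jointly smooth) then `c(t) = 𝓕(θ(t))(k)` satisfies
`c' = −4π²ν|k|² c` within `[a, b]`. [cite: Grafakos2014, Prop. 3.2.6 (8)] -/
theorem Torus.hasDerivWithinAt_mFourierCoeff_heat {a b ν : ℝ} (hab : a < b)
    {θ : ℝ → UnitAddTorus d → ℝ} (hθ : Torus.IsSmoothSpaceTimeOn (Icc a b) θ)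
    (heq : ∀ t ∈ Icc a b, ∀ x, Torus.timeDerivWithin (Icc a b) θ t x = ν * Torus.laplacian (θ t) x)
    (k : d → ℤ) {t : ℝ} (ht : t ∈ Icc a b) :
    HasDerivWithinAt (fun s => mFourierCoeff (fun y => (θ s y : ℂ)) k)
      (-((4 * Real.pi ^ 2 * ν * Torus.freqNormSq k : ℝ) : ℂ) * mFourierCoeff (fun y => (θ t y : ℂ)) k)
      (Icc a b) t := by
  have hU : UniqueDiffOn ℝ (Icc a b) := uniqueDiffOn_Icc hab
  have hθC : Torus.IsSmoothSpaceTimeOn (Icc a b) (fun s y => (θ s y : ℂ)) := hθ.ofReal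
  have h := ScalarFourier.hasDerivWithinAt_mFourierCoeff hθC (convex_Icc a b) hU ht k
  have hθt : Torus.IsSmooth (θ t) := hθ.isSmooth_slice ht
  have hder : Torus.timeDerivWithin (Icc a b) (fun s y => (θ s y : ℂ)) t =
      (ν : ℂ) • Torus.laplacian (fun y => (θ t y : ℂ)) := by
    funext y
    rw [Torus.timeDerivWithin_ofReal hθ hU ht y, heq t ht y, Complex.ofReal_mul, Pi.smul_apply,
      smul_eq_mul, Torus.laplacian_ofReal hθt y]
  rw [hder, Torus.mFourierCoeff_const_smul,
    ScalarFourier.mFourierCoeff_laplacian (g := fun y => ((θ t y : ℝ) : ℂ)) (hθt.comp_clm Complex.ofRealCLM),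
    smul_eq_mul] at h
  convert h using 1
  push_cast
  ring

/-- **The heat multiplier.** For a classical solution of `∂ₜθ = νΔθ` on `[a, b] × 𝕋^d` (`a < b`) and
every frequency `k`: `𝓕(θ(t))(k) = exp(−4π²ν|k|²(t − a)) · 𝓕(θ(a))(k)` for all `t ∈ [a, b]` (the
function `s ↦ exp(4π²ν|k|²(s − a)) 𝓕(θ(s))(k)` has zero derivative within `[a, b]`, hence is constant,
Mathlib `constant_of_derivWithin_zero`). [cite: Grafakos2014, Prop. 3.2.6 (8)] -/
theorem Torus.mFourierCoeff_heat_eq_exp_mul {a b ν : ℝ} (hab : a < b)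
    {θ : ℝ → UnitAddTorus d → ℝ} (hθ : Torus.IsSmoothSpaceTimeOn (Icc a b) θ)
    (heq : ∀ t ∈ Icc a b, ∀ x, Torus.timeDerivWithin (Icc a b) θ t x = ν * Torus.laplacian (θ t) x)
    (k : d → ℤ) {t : ℝ} (ht : t ∈ Icc a b) :
    mFourierCoeff (fun y => (θ t y : ℂ)) k =
      ((Real.exp (-(4 * Real.pi ^ 2 * ν * Torus.freqNormSq k) * (t - a)) : ℝ) : ℂ) *
        mFourierCoeff (fun y => (θ a y : ℂ)) k := by
  set lam : ℝ := 4 * Real.pi ^ 2 * ν * Torus.freqNormSq k with hlam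
  set c : ℝ → ℂ := fun s => mFourierCoeff (fun y => (θ s y : ℂ)) k with hc
  -- `g(s) = e^{λ(s-a)} c(s)` has zero derivative within `[a, b]`
  set g : ℝ → ℂ := fun s => ((Real.exp (lam * (s - a)) : ℝ) : ℂ) * c s with hg
  have hU : UniqueDiffOn ℝ (Icc a b) := uniqueDiffOn_Icc hab
  have hgd : ∀ s ∈ Icc a b, HasDerivWithinAt g 0 (Icc a b) s := by
    intro s hs
    have h1 : HasDerivWithinAt (fun r => ((Real.exp (lam * (r - a)) : ℝ) : ℂ))
        (((lam * Real.exp (lam * (s - a)) : ℝ) : ℂ)) (Icc a b) s := by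
      have he : HasDerivAt (fun r => Real.exp (lam * (r - a))) (Real.exp (lam * (s - a)) * (lam * 1)) s := by
        have := ((hasDerivAt_id s).sub_const a).const_mul lam
        exact (Real.hasDerivAt_exp _).comp s this
      have he' : HasDerivAt (fun r => ((Real.exp (lam * (r - a)) : ℝ) : ℂ))
          (((Real.exp (lam * (s - a)) * (lam * 1) : ℝ) : ℂ)) s := he.ofReal_comp
      rw [show Real.exp (lam * (s - a)) * (lam * 1) = lam * Real.exp (lam * (s - a)) by ring] at he'
      exact he'.hasDerivWithinAt
    have h2 := Torus.hasDerivWithinAt_mFourierCoeff_heat hab hθ heq k hs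
    have h12 : HasDerivWithinAt (fun r => ((Real.exp (lam * (r - a)) : ℝ) : ℂ) * c r)
        (((lam * Real.exp (lam * (s - a)) : ℝ) : ℂ) * c s + ((Real.exp (lam * (s - a)) : ℝ) : ℂ) *
          (-((4 * Real.pi ^ 2 * ν * Torus.freqNormSq k : ℝ) : ℂ) * c s)) (Icc a b) s := h1.mul h2
    refine h12.congr_deriv ?_
    rw [hlam]
    push_cast
    ring
  have hconst := constant_of_derivWithin_zero (f := g) (fun s hs => (hgd s hs).differentiableWithinAt)
    (fun s hs => ((hgd s (Ico_subset_Icc_self hs)).derivWithin (hU s (Ico_subset_Icc_self hs)))) t ht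
  -- unwind: `e^{λ(t-a)} c(t) = c(a)`
  have hga : g a = c a := by simp [hg]
  rw [hga] at hconst
  have hexp : ((Real.exp (lam * (t - a)) : ℝ) : ℂ) ≠ 0 := by
    exact_mod_cast (Real.exp_pos _).ne'
  have key : c t = ((Real.exp (-(lam) * (t - a)) : ℝ) : ℂ) * c a := by
    have e1 : ((Real.exp (-(lam) * (t - a)) : ℝ) : ℂ) * ((Real.exp (lam * (t - a)) : ℝ) : ℂ) = 1 := by
      rw [← Complex.ofReal_mul, ← Real.exp_add]; simp
    calc c t = ((Real.exp (-(lam) * (t - a)) : ℝ) : ℂ) * (((Real.exp (lam * (t - a)) : ℝ) : ℂ) * c t) := by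
          rw [← mul_assoc, e1, one_mul]
      _ = ((Real.exp (-(lam) * (t - a)) : ℝ) : ℂ) * c a := by rw [← hconst]
  simpa [hc, hlam] using key

/-- **Fourier support is preserved by the heat flow**: a vanishing coefficient of the datum stays zero.
[cite: Grafakos2014, Prop. 3.2.6 (8)] -/
theorem Torus.mFourierCoeff_heat_eq_zero {a b ν : ℝ} (hab : a < b)
    {θ : ℝ → UnitAddTorus d → ℝ} (hθ : Torus.IsSmoothSpaceTimeOn (Icc a b) θ)
    (heq : ∀ t ∈ Icc a b, ∀ x, Torus.timeDerivWithin (Icc a b) θ t x = ν * Torus.laplacian (θ t) x)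
    {k : d → ℤ} (hk : mFourierCoeff (fun y => (θ a y : ℂ)) k = 0) {t : ℝ} (ht : t ∈ Icc a b) :
    mFourierCoeff (fun y => (θ t y : ℂ)) k = 0 := by
  rw [Torus.mFourierCoeff_heat_eq_exp_mul hab hθ heq k ht, hk, mul_zero]

/-- **Modulus of the coefficients**: `‖𝓕(θ(t))(k)‖ = exp(−4π²ν|k|²(t−a)) ‖𝓕(θ(a))(k)‖`.
[cite: Grafakos2014, Prop. 3.2.6 (8)] -/
theorem Torus.norm_mFourierCoeff_heat {a b ν : ℝ} (hab : a < b)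
    {θ : ℝ → UnitAddTorus d → ℝ} (hθ : Torus.IsSmoothSpaceTimeOn (Icc a b) θ)
    (heq : ∀ t ∈ Icc a b, ∀ x, Torus.timeDerivWithin (Icc a b) θ t x = ν * Torus.laplacian (θ t) x)
    (k : d → ℤ) {t : ℝ} (ht : t ∈ Icc a b) :
    ‖mFourierCoeff (fun y => (θ t y : ℂ)) k‖ =
      Real.exp (-(4 * Real.pi ^ 2 * ν * Torus.freqNormSq k) * (t - a)) * ‖mFourierCoeff (fun y => (θ a y : ℂ)) k‖ := by
  rw [Torus.mFourierCoeff_heat_eq_exp_mul hab hθ heq k ht, norm_mul, Complex.norm_real,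
    Real.norm_of_nonneg (Real.exp_pos _).le]

/-- **Backward (realignment) form**: the datum's coefficient is recovered from the coefficient at time
`t` by the inverse multiplier, `𝓕(θ(a))(k) = exp(+4π²ν|k|²(t − a)) 𝓕(θ(t))(k)`.
[cite: Grafakos2014, Prop. 3.2.6 (8)] -/
theorem Torus.mFourierCoeff_heat_datum_eq_exp_mul {a b ν : ℝ} (hab : a < b)
    {θ : ℝ → UnitAddTorus d → ℝ} (hθ : Torus.IsSmoothSpaceTimeOn (Icc a b) θ)
    (heq : ∀ t ∈ Icc a b, ∀ x, Torus.timeDerivWithin (Icc a b) θ t x = ν * Torus.laplacian (θ t) x)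
    (k : d → ℤ) {t : ℝ} (ht : t ∈ Icc a b) :
    mFourierCoeff (fun y => (θ a y : ℂ)) k =
      ((Real.exp ((4 * Real.pi ^ 2 * ν * Torus.freqNormSq k) * (t - a)) : ℝ) : ℂ) *
        mFourierCoeff (fun y => (θ t y : ℂ)) k := by
  rw [Torus.mFourierCoeff_heat_eq_exp_mul hab hθ heq k ht, ← mul_assoc, ← Complex.ofReal_mul,
    ← Real.exp_add]
  simp

end Literature.Analysis.FluidPDE

end
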